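import Summits.BirchSwinnertonDyer.BirchSwinnertonDyer.Theorems.SchneiderFreeAdditiveX3AnticycControlAdditiveOfKolyvagin
import Summits.BirchSwinnertonDyer.BirchSwinnertonDyer.Theorems.GrossProp82OfPoitouTate
import HarnessLib

/-!
# Record item `AnticycControlAdditive` (stmt-BirchSwinnertonDyer-19178) ⟸ the THREE remaining leaves of Kolyvagin's theorem

Cell `bsd-schneider-ideate`, seat `bsd-schneider-door-c4` (prover, generation 21).  PARTITION: board row B6 ∩ X3 ∩ sst-twist,
`r = 1`, of `Rank1Residual.partition` — CONTROL corner.  bears_on: K1-door (r1, B6∩X3-sst)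
(route-BirchSwinnertonDyer-SchneiderFreeAdditiveX3 items 18969 → 19178 → 19295).  Supports item 19178 WITHOUT closing it.

Generation 20 recorded `anticycControlAdditive_of_kolyvagin`: the fact-free record 19178 follows from the cite-only fact
`Literature.NumberTheory.EllipticCurves.kolyvagin` ALONE (through the CLOSED crux 19295).  Since then the trust base of
`kolyvagin` itself shrank: cell bsd-wall (seat soed-p2-w2, `Theorems/GrossProp82OfPoitouTate.lean`, 2026-08-28) discharged Gross
1991 Prop. 8.2 from the tree's Poitou–Tate reciprocity, leaving `kolyvagin_of_threeLeaves : Gross1991_kolyvaginClasses →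
Kolyvagin1990_sha_primary_finite → Kolyvagin1990_thmA_of_hasCM_or_discr → kolyvagin N W K`.  This file composes the two:

* `anticycControlAdditive_of_threeLeaves` — **item 19178 follows from the three remaining NAMED leaves of Kolyvagin's theorem**
  (Kolyvagin's classes with Gross's Props. 5.4 (2) / 6.2 — CM theory on `X₀(N)` and the Euler-system relations; the finiteness of
  `Ш(E/K)[p^∞]` beyond Gross's sketch; Theorem A in the CM / `d_K ∈ {−3,−4}` cases), and from nothing else of print.

HONEST FRAMING: no new mathematics (a by-name composition); CONDITIONAL on the three displayed named facts (the gate records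
`proof.conditional`); item 19178 stays OPEN; BSD is NOT advanced.
References: [GrossLMS1991] Thm. 1.3, §§3–6, Prop. 8.2; [Kolyvagin1990] Thm. A; [JetchevSkinnerWan2017] Thm. 3.3.1.
-/

noncomputable section

-- `Summit.<P>.<Sub>` repeats `BirchSwinnertonDyer` by the tree's layout convention (D-0017)
set_option linter.dupNamespace false

namespace Summit.BirchSwinnertonDyer.BirchSwinnertonDyer.Theorems.SchneiderFreeAdditiveX3

open Literature.NumberTheory.EllipticCurves

/-- **Item 19178 `AnticycControlAdditive` from the three remaining leaves of Kolyvagin's theorem**: the fact-free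
anticyclotomic control record on B6 ∩ X3 ∩ sst-twist, `r_an = 1`, `p` odd, follows from (i) Kolyvagin's classes with Gross's
Props. 5.4 (2), 6.2 (`Gross1991_kolyvaginClasses`), (ii) the finiteness of the `p`-primary parts of `Ш(E/K)`
(`Kolyvagin1990_sha_primary_finite`) and (iii) Theorem A for `E` CM or `d_K ∈ {−3,−4}` (`Kolyvagin1990_thmA_of_hasCM_or_discr`),
via bsd-wall's `GrossProp82OfPoitouTate.kolyvagin_of_threeLeaves` (Prop. 8.2 discharged from Poitou–Tate) and generation 20's
`anticycControlAdditive_of_kolyvagin` (the closed crux 19295).  CONDITIONAL on the three named facts, none of which is proved here.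
[cite: GrossLMS1991, Thm. 1.3 with §§3–6 and Prop. 8.2] [cite: Kolyvagin1990, Thm. A]
[cite: JetchevSkinnerWan2017, Thm. 3.3.1 (arXiv:1512.06894 p. 11)] -/
theorem anticycControlAdditive_of_threeLeaves
    (hA1 : ∀ (N : ℕ) [NeZero N] (W : WeierstrassCurve ℚ) (K : Type) [Field K] [NumberField K],
      Gross1991_kolyvaginClasses N W K)
    (hSha : ∀ (N : ℕ) [NeZero N] (W : WeierstrassCurve ℚ) (K : Type) [Field K] [NumberField K],
      Kolyvagin1990_sha_primary_finite N W K)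
    (hexc : ∀ (N : ℕ) [NeZero N] (W : WeierstrassCurve ℚ) (K : Type) [Field K] [NumberField K],
      Kolyvagin1990_thmA_of_hasCM_or_discr N W K) :
    Summit.BirchSwinnertonDyer.BirchSwinnertonDyer.Theses.SchneiderFreeAdditiveX3.AnticycControlAdditive :=
  anticycControlAdditive_of_kolyvagin fun N _ W K _ _ =>
    GrossProp82OfPoitouTate.kolyvagin_of_threeLeaves N W K (hA1 N W K) (hSha N W K) (hexc N W K)

/-- The same for the Kolyvagin-prefixed target re-typing `StepLManinK` (item 19393) is not possible here (it also needs the two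
analytic cruxes r2/r3); but the CLOSED crux `AnticycControlAdditiveK` (19295) instantiated at the three leaves gives the control
input `AdditiveControlInputManinAt` on the cell outright. [cite: GrossLMS1991, Thm. 1.3] [cite: JetchevSkinnerWan2017, Thm. 3.3.1] -/
theorem additiveControlInputManinAt_of_threeLeaves
    (hA1 : ∀ (N : ℕ) [NeZero N] (W : WeierstrassCurve ℚ) (K : Type) [Field K] [NumberField K],
      Gross1991_kolyvaginClasses N W K)
    (hSha : ∀ (N : ℕ) [NeZero N] (W : WeierstrassCurve ℚ) (K : Type) [Field K] [NumberField K],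
      Kolyvagin1990_sha_primary_finite N W K)
    (hexc : ∀ (N : ℕ) [NeZero N] (W : WeierstrassCurve ℚ) (K : Type) [Field K] [NumberField K],
      Kolyvagin1990_thmA_of_hasCM_or_discr N W K)
    (W : WeierstrassCurve ℚ) [W.IsElliptic] [W.IsGloballyMinimal] (p : ℕ) [Fact p.Prime]
    (hr : W.analyticRank = 1) (hp : p ≠ 2) (hX : Rank1Residual.ClassX3 W p)
    (hS : Summit.BirchSwinnertonDyer.Rank1Residual.Additive.SubSemistableTwist W p) :
    SchneiderFree.AdditiveControlInputManinAt W p :=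
  anticycControlAdditive_of_threeLeaves hA1 hSha hexc W p hr hp hX hS

end Summit.BirchSwinnertonDyer.BirchSwinnertonDyer.Theorems.SchneiderFreeAdditiveX3

end
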